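import Summits.ResolutionOfSingularities.ResolutionOfSingularities.Theorems.HilbertSamuelEliminationSigmaMaxModificationsCorridor3WLadderIsoLowFree
import Summits.ResolutionOfSingularities.ResolutionOfSingularities.Theorems.HilbertSamuelEliminationSigmaMaxModificationsCorridor3WLadderMovingTwoResidue
import Summits.ResolutionOfSingularities.ResolutionOfSingularities.Theorems.HilbertSamuelEliminationSigmaMaxModificationsCorridor3InducesIsoOnPoint
import Summits.ResolutionOfSingularities.ResolutionOfSingularities.Theorems.HilbertSamuelEliminationSigmaMaxModificationsCorridor3Directrix214Sharp
import Literature.AlgebraicGeometry.Resolution.ExcellentBlowup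
import HarnessLib

/-!
# [OURS · L1 W4.2] β-PORT, PART 2: THE `e = 1` BRIDGE `IsoE1BridgeFreeM p` AND THE THIRD-DOOR SOCKET
# `IsoLowDirDimTerminatesFreeM p` OF THE CHARACTERISTIC-2 ROW `stub_Wlow3M_two`, MODULO THE (F1♯) BINDERS
# (crux chain w42, line `w_ladder`; `--supports stmt-…-19249`, helper)

OURS (cell res-hironaka, slot W4.2, seat res-L1-w42-stub-2 gen 3); NOT statements of H. Hironaka's manuscript [Hironaka2017]
nor of [CossartJannsenSaito2020]. AI-drafted, weaker than expert review. Sorry-free PROOF file (no new definition). This is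
stub-2's characteristic pipeline (`…WLadderIsoLowSocket`, p510638: moving chain ↦ genuine stages ↦ tower of point blow-ups
over `Spec 𝒪_{X_{n_0},x_{n_0}}` ↦ fundamental sequence of length `∞`) run in the (F1♯) form per res-L1-w42-plan-1 RULINGS
v3.11 (3)/(15)(c): it DISCHARGES stub-3's OURS construction `IsoE1BridgeFreeM p` (the binder `hB₂` of `wlow3TwoM_of_residue`)
from the binders BY NAME `Theorem314_geomDir`, `Thm314_point_locus_geomDir` (stub-3's (F1♯) shadows of CJS Thm. 3.14),
`ProjDir_line` (p503241) and `CossartJannsenSaito2020_thm_3_10_4` (p499783); with stub-3's carrier `Corollary637_geomDir`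
it closes the socket `IsoLowDirDimTerminatesFreeM p`. The two LIB inputs are theorems of the tree (res-type-053's
`isExcellent_of_isBlowup`, lead-1's `Helpers.inducesIsoOn_singleton_of_isIso_residueFieldMap`).

* `Moving.isFundamentalSequence_top_of_localTower_geomDir` — **a tower of blow-ups in closed points `y_j ↦ y_{j−1}` with
  `H` constant, `e = 1` and (F1♯) at every `y_j` IS a fundamental sequence of `B`-permissible blow-ups over `y_0` of
  length `∞`** (CJS Def. 6.34): near points lie on `ℙ(Dir)` (`Thm314_point_locus_geomDir`), a single rational point
  (`ProjDir_line`), so the near locus at stage `j` is `{y_j}` and `C_j ≅ C_{j−1}`.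
* `Moving.thm314_point_locus_geomDir_of_sharp` — the binder `Thm314_point_locus_geomDir` from the print-faithful
  `Thm314_point_locus` (characteristic `0`) and res-type-001's 2.14♯ `Directrix214Sharp` (positive characteristic).
* `Moving.isoE1BridgeFreeM_of_facts` — **THE BRIDGE**: from an ISOLATED reached stage with `e = 1`, `ē ≤ 2` (any prime,
  `ν ≠ Φ^{(3)}`), a moving grade-`ē ≤ 2` chain out of it yields a tower in the key setting with (F1♯), a fundamental
  sequence of length `∞` at an isolated point with `e = 1`.
* `Moving.isoLowDirDimTerminatesFreeM_of_facts` — **THE SOCKET** (stub-3's `isoLowDirDimTerminatesFreeM_of_bridge`).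
* `Moving.wlow3TwoM_of_residue_of_facts` — the characteristic-`2` row with `hB₂` discharged (residue: `KeyTheorem640_isolated`,
  `Corollary637_geomDir`, `Theorem314_geomDir`, `Thm314_point_locus_geomDir`, `ProjDir_line`, Thm. 3.10 (4),
  `UnitTowerExtractionFreeM 2`, `WlowStrataM 2`).

## References

* V. Cossart, U. Jannsen, S. Saito, LNM 2270 (2020): Thm. 2.14, Thm. 3.10 (4), Thm. 3.14, Def. 6.34, Cor. 6.37, p. 107.
  [CossartJannsenSaito2020]
-/

noncomputable section

-- namespace `…Corridor3.Moving` re-enters `…Corridor3` (module convention of the Moving files)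
set_option linter.dupNamespace false

open CategoryTheory CategoryTheory.Limits AlgebraicGeometry TopologicalSpace IsLocalRing
open Literature.AlgebraicGeometry.Resolution Literature.RingTheory.HilbertSamuel
open Scheme.IdealSheafData

universe u

open Summit.ResolutionOfSingularities.ResolutionOfSingularities.Theorems.CampaignW42
open Literature.AlgebraicGeometry.CossartJannsenSaito2020
open Summit.ResolutionOfSingularities.ResolutionOfSingularities.Theorems.SigmaMaxModificationsCorridor3

namespace Summit.ResolutionOfSingularities.ResolutionOfSingularities.Theorems.SigmaMaxModificationsCorridor3.Moving

variable {R : ∀ S : Scheme.{u}, CentreSeq S → Prop} {ν : ℕ → ℕ}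

/-! ## The binder `Thm314_point_locus_geomDir` from print (char `0`) and 2.14♯ (char `> 0`) -/

/-- **`Thm314_point_locus_geomDir` from the print-faithful `Thm314_point_locus` (characteristic `0`, where (F1) holds in
every dimension) and res-type-001's 2.14♯ `Directrix214Sharp` (positive characteristic, `ē_x + 2 ≤ 2·char κ(x)`).**
[cite: CossartJannsenSaito2020, Thm. 2.14, Thm. 3.14] -/
theorem thm314_point_locus_geomDir_of_sharp (hsharp : Directrix214Sharp.Directrix214Sharp.{u}) (h314pt : Thm314_point_locus.{u}) :
    Thm314_point_locus_geomDir.{u} := by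
  intro X X' _ π x hx N x' hexc hperm hπ hdim hx' hgeo hnear
  rcases Nat.eq_zero_or_pos (ringChar (ResidueField (X.presheaf.stalk x))) with h0 | hpos
  · -- characteristic `0`: (F1) holds (`dim X` is finite, `≤ N`)
    obtain ⟨d, hd, -⟩ := exists_topologicalKrullDim_eq x hdim
    exact h314pt X X' π x hx N x' hexc hperm hπ hdim hx' ⟨d, hd, Or.inl h0⟩ hnear
  · -- positive characteristic: 2.14♯
    rcases hgeo with h0 | hle
    · exact absurd h0 hpos.ne'
    · exact hsharp X X' π x hx N x' hexc hperm hπ hdim hx' hpos hle hnear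

/-! ## The fundamental sequence of length `∞` on a tower of point blow-ups, (F1♯) form -/

/-- **A tower of blow-ups in closed points `y_j ↦ y_{j−1}` with `H^N(y_j)` constant, `e_{y_j} = 1` and (F1♯) at every
`y_j`, in the key setting, IS a fundamental sequence of `B`-permissible blow-ups over `y_0` of length `∞`** (CJS Def. 6.34 with
`m = ⊤`): blow-ups of locally noetherian excellent schemes stay excellent (`isExcellent_of_isBlowup`); near points over `y_j`
lie on `ℙ(Dir_{y_j})` (`Thm314_point_locus_geomDir`), which for `e = 1` is the single `κ(y_j)`-rational point `y_{j+1}`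
(`ProjDir_line`), so the near locus of `y_0` at stage `j` is `{y_j} = C_j` and `C_{j+1} ≅ C_j`
(`Helpers.inducesIsoOn_singleton_of_isIso_residueFieldMap`). The (F1♯) twin of the construction inside stub-2's
`false_of_localTower_grade_one`. [cite: CossartJannsenSaito2020, Def. 6.34, Cor. 6.37, Thm. 3.14, Thm. 2.14] -/
theorem isFundamentalSequence_top_of_localTower_geomDir (h214 : Thm314_point_locus_geomDir.{u}) (hline : ProjDir_line.{u})
    {N : ℕ} (T : BlowupTower.{u}) (y : ∀ j, T.X j) (hC : ∀ j, T.C j = {y j})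
    (hycl : ∀ j, IsClosed ({y j} : Set (T.X j))) (hover : ∀ j, (T.π j).base (y (j + 1)) = y j)
    (hkey : KeySetting T N) (hgeo : ∀ j, @GeomDirHypothesis (T.X j) (T.ln j) (y j))
    (hH : ∀ j, Scheme.hsFun (T.X j) N (y j) = Scheme.hsFun (T.X 0) N (y 0))
    (he : ∀ j, @Scheme.dirDim (T.X j) (T.ln j) (y j) = 1) : IsFundamentalSequence T N (y 0) ⊤ := by
  haveI : ∀ j, IsLocallyNoetherian (T.X j) := T.ln
  -- the centres as `Closeds`
  have hCl : ∀ j, (⟨T.C j, T.isClosed_C j⟩ : Closeds (T.X j)) = ⟨{y j}, hycl j⟩ := fun j => Closeds.ext (hC j)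
  have blow : ∀ j, IsBlowup (T.π j) (vanishingIdeal (⟨{y j}, hycl j⟩ : Closeds (T.X j))) := fun j =>
    hCl j ▸ T.isBlowup j
  -- excellence and dimension along the tower
  have exc : ∀ j, Scheme.IsExcellent (T.X j) := by
    intro j
    induction j with
    | zero => exact hkey.excellent
    | succ j ih => exact isExcellent_of_isBlowup (T.isBlowup j) ih
  have dimN : ∀ j, topologicalKrullDim (T.X j) ≤ (N : WithBot ℕ∞) := by
    intro j
    induction j with
    | zero => exact hkey.dim_le
    | succ j ih => exact (T.isBlowup j).topologicalKrullDim_le_of_isLocallyNoetherian ih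
  -- permissible point centres, `H` does not increase
  have perm : ∀ j, IdealSheafData.IsPermissible (vanishingIdeal (⟨{y j}, hycl j⟩ : Closeds (T.X j))) :=
    fun j => isPermissible_singleton_of_one_le_dirDim (hycl j) (he j).symm.le
  have mono : ∀ j (ξ : T.X (j + 1)), Scheme.hsFun (T.X (j + 1)) N ξ ≤ Scheme.hsFun (T.X j) N ((T.π j).base ξ) :=
    fun j ξ => (blow j).hsFun_le_of_isPermissible (exc j) (perm j) N ξ
  have over_phi : ∀ j, (T.phi j).base (y j) = y 0 := by
    intro j
    induction j with
    | zero => rfl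
    | succ j ih => rw [BlowupTower.phi_succ_base, hover, ih]
  have le_of_over : ∀ j (ξ : T.X j), (T.phi j).base ξ = y 0 →
      Scheme.hsFun (T.X j) N ξ ≤ Scheme.hsFun (T.X 0) N (y 0) := by
    intro j
    induction j with
    | zero => intro ξ hξ; exact (congrArg _ hξ).le
    | succ j ih =>
      intro ξ hξ
      rw [BlowupTower.phi_succ_base] at hξ
      exact (mono j ξ).trans (ih _ hξ)
  -- near points over `y_j` lie on `ℙ(Dir_{y_j})`, which is the single point `y_{j+1}`
  have onDir : ∀ j (ξ : T.X (j + 1)), (T.π j).base ξ = y j →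
      Scheme.hsFun (T.X (j + 1)) N ξ = Scheme.hsFun (T.X j) N (y j) → IsOnProjDirectrix (T.π j) ξ :=
    fun j ξ hξ hnear => h214 (T.X j) (T.X (j + 1)) (T.π j) (y j) (hycl j) N ξ (exc j) (perm j) (blow j)
      (dimN j) hξ (hgeo j) hnear
  have ymem : ∀ j, y (j + 1) ∈ projDirectrixFibre (T.π j) (y j) := fun j =>
    (mem_projDirectrixFibre _ _ _).mpr ⟨hover j, onDir j (y (j + 1)) (hover j) (by rw [hH (j + 1), hH j])⟩
  have uniq : ∀ j (ξ : T.X (j + 1)), (T.π j).base ξ = y j →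
      Scheme.hsFun (T.X (j + 1)) N ξ = Scheme.hsFun (T.X j) N (y j) → ξ = y (j + 1) :=
    fun j ξ hξ hnear => (hline (T.X j) (T.X (j + 1)) (T.π j) (y j) (hycl j) (blow j) (he j)).1
      ((mem_projDirectrixFibre _ _ _).mpr ⟨hξ, onDir j ξ hξ hnear⟩) (ymem j)
  -- the near locus of `y_0` at stage `j` is `{y_j}`
  have near_iff : ∀ j (ξ : T.X j), ξ ∈ T.nearLocus N (y 0) j ↔ ξ = y j := by
    intro j
    induction j with
    | zero => intro ξ; rw [BlowupTower.nearLocus_zero, Set.mem_singleton_iff]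
    | succ j ih =>
      intro ξ
      rw [BlowupTower.mem_nearLocus]
      constructor
      · rintro ⟨hφ, hHξ⟩
        rw [BlowupTower.phi_succ_base] at hφ
        have h1 : Scheme.hsFun (T.X j) N ((T.π j).base ξ) = Scheme.hsFun (T.X 0) N (y 0) :=
          le_antisymm (le_of_over j _ hφ) (hHξ ▸ mono j ξ)
        have h2 : (T.π j).base ξ = y j := (ih _).mp ((BlowupTower.mem_nearLocus _ _ _ _ _).mpr ⟨hφ, h1⟩)
        exact uniq j ξ h2 (by rw [hHξ, hH j])
      · rintro rfl
        exact ⟨over_phi _, hH _⟩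
  -- rational near points: `C_{j+1} = {y_{j+1}} ≅ {y_j} = C_j`
  have iso : ∀ j, InducesIsoOn (T.π j) {y (j + 1)} (hycl (j + 1)) {y j} (hycl j) := by
    intro j
    haveI : IsIso ((T.π j).residueFieldMap (y (j + 1))) :=
      (hline (T.X j) (T.X (j + 1)) (T.π j) (y j) (hycl j) (blow j) (he j)).2 (y (j + 1)) (ymem j)
    exact Helpers.inducesIsoOn_singleton_of_isIso_residueFieldMap (T.π j) (hycl (j + 1)) (hycl j) (hover j)
  -- the fundamental sequence of length `⊤`
  have hdir0 : T.dirDimAt 0 (y 0) = 1 := by rw [BlowupTower.dirDimAt_eq]; exact he 0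
  exact
    { one_le_dirDim := hdir0.symm.le
      one_le_length := le_top
      isClosed_point := hycl 0
      centre_zero := hC 0
      centre_one := fun _ => by
        ext ξ
        rw [hC 1, Set.mem_singleton_iff, BlowupTower.projDir]
        constructor
        · rintro rfl; exact ymem 0
        · intro hξ; exact (hline (T.X 0) (T.X 1) (T.π 0) (y 0) (hycl 0) (blow 0) (he 0)).1 hξ (ymem 0)
      centre_near := fun q _ _ => by
        ext ξ
        rw [hC q, Set.mem_singleton_iff, near_iff]
      permissible := fun q _ => by
        show IdealSheafData.IsPermissible (vanishingIdeal ⟨T.C q, T.isClosed_C q⟩)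
        rw [hCl q]; exact perm q
      iso := fun j _ _ =>
        inducesIsoOn_of_eq (T.π j) (hC (j + 1)) (T.isClosed_C (j + 1)) (hycl (j + 1)) (hC j) (T.isClosed_C j)
          (hycl j) (iso j)
      stop_one := fun h => absurd h (by simp)
      stop_finite := fun j _ h => absurd h (ENat.top_ne_coe _) }

/-! ## The bridge and the socket -/

/-- **THE `e = 1` BRIDGE `IsoE1BridgeFreeM p` MODULO THE (F1♯) BINDERS** (any prime `p`): from a stage `s` reached from a
maximal origin (`ν ≠ Φ^{(3)}`) whose marked point is ISOLATED in the Hilbert–Samuel locus with `e = 1`, `ē ≤ 2`, every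
moving chain of canonical near steps out of `s` produces a tower `T` in the key setting with (F1♯) at its initial point,
a fundamental sequence of length `∞` there, the initial point isolated with `e = 1`. Route: re-base the chain at `s`
(`exists_chain_from_of_reaches`); `ē ≤ 2` and `e ≤ 1` all along (`geomDirDim_chain_le`, `dirDim_le_one_of_chain_geomDir`),
`e = 1` at blown-up stages (stub-3's `false_of_isBlownUp_of_dirDim_eq_zero_geomDir`); blown-up stages are point-centred
(stub-3's `stalkIdeal_centre_eq_maximalIdeal_of_reaches_geomDir`), so the fact-free local tower exists
(`exists_localTower_of_movingChain_wait_of_pointCentres`); the local rings along it are those of the genuine stages, whence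
`H`, `e = 1`, `ē ≤ 2` ((F1♯)) transfer; isolation transfers to `Spec 𝒪` along the waiting prefix; and the tower is a
fundamental sequence of length `∞` (`isFundamentalSequence_top_of_localTower_geomDir`).
[cite: CossartJannsenSaito2020, Def. 6.34, Cor. 6.37, Thm. 3.14, Thm. 3.10 (4), p. 107] -/
theorem isoE1BridgeFreeM_of_facts (hF : Theorem314_geomDir.{0}) (h3104 : CossartJannsenSaito2020_thm_3_10_4.{0})
    (h214 : Thm314_point_locus_geomDir.{0}) (hline : ProjDir_line.{0}) (p : ℕ) : IsoE1BridgeFreeM p := by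
  intro R hRf hRa ν X _ x hX hν s hreach hiso hes1 hē c hc0 hstep _ hmov
  haveI : IsLocallyNoetherian s.W := s.ln
  obtain ⟨k, _, _, f, -, hft, hqc⟩ := hX.exists_structure
  haveI := hft
  haveI := hqc
  haveI := hX.isReduced
  -- re-base the chain at `s`
  obtain ⟨c', hc'0, hstep', hmov'⟩ := exists_chain_from_of_reaches hc0 (c := c) rfl hstep hmov
  have h0' : Reaches R 3 ν (MarkedStage.init X x) (c' 0) := by rw [hc'0]; exact hreach
  have hreach' : ∀ n, Reaches R 3 ν (MarkedStage.init X x) (c' n) := reaches_chain h0' hstep'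
  have hgood : ∀ n, StateGood k R 3 ν (c' n).W (c' n).L (c' n).P := fun n =>
    stateGood_of_reaches (stateGood_init_general hRa f hX.dim_le hX.maximal hν) (hreach' n)
  haveI : ∀ n, IsLocallyNoetherian (c' n).W := fun n => (c' n).ln
  have hpt : ∀ n, (c' n).pt ∈ Scheme.hsStratum (c' n).W 3 ν := fun n =>
    pt_mem_hsStratum_of_reaches hX.mem_stratum (hreach' n)
  -- `ē ≤ 2` and `e ≤ 1` all along; `e = 1` at blown-up stages
  have hGle : ∀ n, (c' n).geomDirDim ≤ 2 := fun n =>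
    (geomDirDim_chain_le h3104 hRa hX hν h0' hstep' n).trans (by rw [hc'0]; exact hē)
  have hEle : ∀ n, dirDim (c' n) ≤ 1 :=
    dirDim_le_one_of_chain_geomDir hF h3104 h214 hline hRf hRa hX hν h0' hstep' (by rw [hc'0]; exact hes1.le)
      (by rw [hc'0]; exact hē)
  have hE1 : ∀ n, (c' n).IsBlownUp R 3 ν → dirDim (c' n) = 1 := by
    intro n hb
    rcases Nat.lt_or_ge (dirDim (c' n)) 1 with hlt | hge
    · exact (false_of_isBlownUp_of_dirDim_eq_zero_geomDir hF hRf hRa hX (hreach' n) hb (hstep' n) (by omega)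
        (hGle n)).elim
    · exact le_antisymm (hEle n) hge
  -- the fact-free local tower over the point-centred blown-up stages
  obtain ⟨g, T, y, -, hgb, -, hwait, hC, hycl, hover, hstalk, hkey, -, hisol⟩ :=
    exists_localTower_of_movingChain_wait_of_pointCentres hRf hRa hX hν h0' hstep' hmov' fun n C P' hcs hmem =>
      stalkIdeal_centre_eq_maximalIdeal_of_reaches_geomDir hF hRf hRa hX hν (hreach' n) (hstep' n) (hEle n) (hGle n)
        hcs hmem
  haveI : ∀ j, IsLocallyNoetherian (T.X j) := T.ln
  have hH : ∀ j, Scheme.hsFun (T.X j) 3 (y j) = Scheme.hsFun (T.X 0) 3 (y 0) := by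
    intro j
    obtain ⟨ej⟩ := hstalk j
    obtain ⟨e0⟩ := hstalk 0
    rw [hsFun_eq_of_stalkIso ej, hsFun_eq_of_stalkIso e0, Scheme.mem_hsStratum_iff.mp (hpt _),
      Scheme.mem_hsStratum_iff.mp (hpt _)]
  have he : ∀ j, @Scheme.dirDim (T.X j) (T.ln j) (y j) = 1 := by
    intro j
    obtain ⟨ej⟩ := hstalk j
    rw [dirDim_eq_of_stalkIso ej]
    exact hE1 _ (hgb j)
  have hgeo : ∀ j, @GeomDirHypothesis (T.X j) (T.ln j) (y j) := by
    intro j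
    obtain ⟨ej⟩ := hstalk j
    apply geomDirHypothesis_of_geomDirDim_le_two
    rw [geomDirDim_eq_of_stalkIso ej]
    have h := hGle (g j)
    rw [MarkedStage.geomDirDim] at h
    exact h
  have hkey3 : KeySetting T 3 :=
    hkey 3 (hgood (g 0)).isExcellent (dim_le_of_reaches (hreach' (g 0)) (d := 3) hX.dim_le)
  have hisol0 : @IsIsolatedInHSMaxLocus (T.X 0) (T.ln 0) 3 (y 0) := by
    apply hisol 3
    let T₀ : BlowupTower.{0} :=
      { X := fun _ => (c' 0).W, ln := fun _ => (c' 0).ln, C := fun _ => ∅, isClosed_C := fun _ => isClosed_empty,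
        π := fun _ => 𝟙 (c' 0).W, isBlowup := fun _ => isBlowup_id_vanishingIdeal_empty (c' 0).W }
    obtain ⟨f₀, hf₀, -⟩ := (hgood 0).overField
    haveI := hf₀
    have hsc : ∀ w : (c' 0).W, w ⤳ (c' 0).pt → Scheme.hsFun (c' 0).W 3 w ≤ Scheme.hsFun (c' 0).W 3 (c' 0).pt :=
      fun w hw => Scheme.hsFun_le_hsFun_of_specializes_over_field f₀ 3 hw
    have hiso' : @IsIsolatedInHSMaxLocus (c' 0).W (c' 0).ln 3 (c' 0).pt := by rw [hc'0]; exact hiso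
    have h1 : IsIsolatedInHSMaxLocus (Spec ((c' 0).W.presheaf.stalk (c' 0).pt)) 3
        (closedPoint ((c' 0).W.presheaf.stalk (c' 0).pt)) := T₀.isIsolatedInHSMaxLocus_localize (c' 0).pt 3 hsc hiso'
    obtain ⟨ew⟩ := nonempty_stalkIso_of_waiting hstep' (a := 0) (b := g 0) (Nat.zero_le _)
      (fun m _ hm => hwait m hm)
    exact isIsolatedInHSMaxLocus_spec_of_iso ew 3 h1
  have hdir0 : T.dirDimAt 0 (y 0) = 1 := by rw [BlowupTower.dirDimAt_eq]; exact he 0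
  exact ⟨T, y 0, hkey3, hgeo 0,
    isFundamentalSequence_top_of_localTower_geomDir h214 hline T y hC hycl hover hkey3 hgeo hH he, hisol0, hdir0⟩

/-- **THE THIRD-DOOR SOCKET `IsoLowDirDimTerminatesFreeM p` OF THE CHARACTERISTIC-2 ROW MODULO THE (F1♯) BINDERS** (any
prime `p`): `Theorem314_geomDir`, `Thm314_point_locus_geomDir`, `ProjDir_line`, `CossartJannsenSaito2020_thm_3_10_4` and
stub-3's carrier `Corollary637_geomDir` — stub-3's `isoLowDirDimTerminatesFreeM_of_bridge` with its bridge discharged.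
[cite: CossartJannsenSaito2020, Cor. 6.37, Def. 6.34, Thm. 3.14] -/
theorem isoLowDirDimTerminatesFreeM_of_facts (hF : Theorem314_geomDir.{0}) (h3104 : CossartJannsenSaito2020_thm_3_10_4.{0})
    (h214 : Thm314_point_locus_geomDir.{0}) (hline : ProjDir_line.{0}) (hC : Corollary637_geomDir.{0}) (p : ℕ) :
    IsoLowDirDimTerminatesFreeM p :=
  isoLowDirDimTerminatesFreeM_of_bridge hF hC (isoE1BridgeFreeM_of_facts hF h3104 h214 hline p)

/-- **THE CHARACTERISTIC-2 ROW FROM ITS RESIDUE, `hB₂` DISCHARGED**: `∀ p, p.Prime → Wlow3TwoM p` from the OURS claims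
`KeyTheorem640_isolated`, `Corollary637_geomDir`, the (F1♯) shadows `Theorem314_geomDir` / `Thm314_point_locus_geomDir`, the
printed `ProjDir_line` / Thm. 3.10 (4), and the two remaining OURS constructions `UnitTowerExtractionFreeM 2`, `WlowStrataM 2`
(stub-3's `wlow3TwoM_of_residue`). [cite: CossartJannsenSaito2020, Thm. 6.40, Cor. 6.37, Thm. 3.14] -/
theorem wlow3TwoM_of_residue_of_facts (hK : KeyTheorem640_isolated.{0}) (hC : Corollary637_geomDir.{0})
    (hF : Theorem314_geomDir.{0}) (h3104 : CossartJannsenSaito2020_thm_3_10_4.{0}) (h214 : Thm314_point_locus_geomDir.{0})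
    (hline : ProjDir_line.{0}) (hU : UnitTowerExtractionFreeM 2) (hS : WlowStrataM 2) : ∀ p : ℕ, p.Prime → Wlow3TwoM.{0} p :=
  wlow3TwoM_of_residue hK hC hF (isoE1BridgeFreeM_of_facts hF h3104 h214 hline 2) hU hS

end Summit.ResolutionOfSingularities.ResolutionOfSingularities.Theorems.SigmaMaxModificationsCorridor3.Moving

end
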